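import Literature.ModelTheory.ExponentialFields.SemialgebraicDimension
import HarnessLib

/-!
# `C¹` cells and the `C¹` cell decomposition theorem (van den Dries, Ch. 7 §3)

Topic `Literature/ModelTheory/ExponentialFields` — infrastructure for the `C¹` layer of the
`C¹`-triangulation theorem [OhmotoShiota2017] (strata on which maps are `C¹`), in the real
semialgebraic setting and in the cylindrical-decomposition vocabulary of
`CylindricalDecomposition.lean` / `SemialgebraicDimension.lean`:

* `IsC1On f S` — `f` is `C¹` on the (not necessarily open) set `S`: the restriction of a `C¹`
  function on an open neighbourhood of `S` [Dries1998, Ch. 7 (3.1)(1)];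
* `IsC1SACell k n d C` — **`C¹` cells** [Dries1998, Ch. 7 (3.1)(2)]: cells (`IsSACell`) whose
  defining sections are moreover `C¹` on their cells; `IsC1SACell.isSACell`;
  `IsC1SACell.exists_c1_chart` — the chart `p_C : C → p(C)` has a `C¹` inverse;
* `exists_refined_stack` — restricting the sections of a cylindrical decomposition of `ℝⁿ⁺¹` to a
  refinement of its base gives a cylindrical decomposition refining it;
* `IsC1CAD`, `c1_cell_decomposition`, `exists_c1CAD`, `exists_c1CAD_c1On` — **the `C¹` cell
  decomposition theorem** [Dries1998, Ch. 7 (3.2)] `(I_m)` and `(II_m)`: finite families of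
  semialgebraic sets are partitioned by cylindrical decompositions into `C¹` cells, and a
  semialgebraic function is `C¹` on the cells of a suitable such decomposition of its domain.
  (`(III_m)` of loc. cit. is replaced by generic smoothness,
  `IsSemialgebraicFunOn.exists_contDiffOn_holds`.)

No named facts are introduced.

## References

* [Dries1998] L. van den Dries, *Tame topology and o-minimal structures*, LMS Lecture Note Series
  248, CUP 1998, Ch. 7, §3, (3.1)–(3.2).
* [BasuPollackRoy2006] S. Basu, R. Pollack, M.-F. Roy, *Algorithms in Real Algebraic Geometry*,
  2nd ed., Springer 2006, Def. 5.1.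
-/

open Set Filter
open _root_.Topology
open scoped ContDiff

namespace Literature.ModelTheory.ExponentialFields

open Literature.NumberTheory.Transcendental (IsSemialgebraicFunOn IsSemialgebraicMapOn
  isSemialgebraicFunOn_iff)

/-! ## `C¹` functions on sets and `C¹` cells [Dries1998, Ch. 7 (3.1)] -/

section C1Cells

variable {n : ℕ}

/-- **`C¹` on a not necessarily open set** [Dries1998, Ch. 7 (3.1)(1)]: `f` is `C¹` on `S` if it is
the restriction to `S` of a `C¹` function on an open neighbourhood of `S` (definability of the
extension is not recorded). [cite: Dries1998, Ch. 7 (3.1)] -/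
def IsC1On (f : (Fin n → ℝ) → ℝ) (S : Set (Fin n → ℝ)) : Prop :=
  ∃ U : Set (Fin n → ℝ), IsOpen U ∧ S ⊆ U ∧ ∃ F : (Fin n → ℝ) → ℝ, ContDiffOn ℝ 1 F U ∧ EqOn F f S

/-- Restriction. [cite: Dries1998, Ch. 7 (3.1)] -/
theorem IsC1On.mono {f : (Fin n → ℝ) → ℝ} {S T : Set (Fin n → ℝ)} (h : IsC1On f S) (hT : T ⊆ S) :
    IsC1On f T := by
  obtain ⟨U, hU, hSU, F, hF, hFf⟩ := h
  exact ⟨U, hU, hT.trans hSU, F, hF, hFf.mono hT⟩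

/-- A `C¹` function on an open set is `C¹` on its subsets. [cite: Dries1998, Ch. 7 (3.1)] -/
theorem IsC1On.of_contDiffOn {f : (Fin n → ℝ) → ℝ} {U S : Set (Fin n → ℝ)} (hU : IsOpen U)
    (hF : ContDiffOn ℝ 1 f U) (hS : S ⊆ U) : IsC1On f S :=
  ⟨U, hU, hS, f, hF, fun _ _ => rfl⟩

/-- Changing the function on the set. [cite: Dries1998, Ch. 7 (3.1)] -/
theorem IsC1On.congr {f g : (Fin n → ℝ) → ℝ} {S : Set (Fin n → ℝ)} (h : IsC1On f S)
    (hfg : EqOn f g S) : IsC1On g S := by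
  obtain ⟨U, hU, hSU, F, hF, hFf⟩ := h
  exact ⟨U, hU, hSU, F, hF, fun x hx => (hFf hx).trans (hfg hx)⟩

/-- `C¹` functions are continuous on the set. [cite: Dries1998, Ch. 7 (3.1)] -/
theorem IsC1On.continuousOn {f : (Fin n → ℝ) → ℝ} {S : Set (Fin n → ℝ)} (h : IsC1On f S) :
    ContinuousOn f S := by
  obtain ⟨U, _, hSU, F, hF, hFf⟩ := h
  exact (hF.continuousOn.mono hSU).congr fun x hx => (hFf hx).symm

/-- Composition with a `C¹` map (e.g. a coordinate projection): if `g` is `C¹` on `B` and `p` maps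
`P` into `B`, then `g ∘ p` is `C¹` on `P`. [cite: Dries1998, Ch. 7 (3.1)] -/
theorem IsC1On.comp_contDiff {d : ℕ} {g : (Fin d → ℝ) → ℝ} {B : Set (Fin d → ℝ)} (hg : IsC1On g B)
    {p : (Fin n → ℝ) → (Fin d → ℝ)} (hp : ContDiff ℝ 1 p) {P : Set (Fin n → ℝ)} (hP : MapsTo p P B) :
    IsC1On (g ∘ p) P := by
  obtain ⟨U, hU, hBU, G, hG, hGg⟩ := hg
  refine ⟨p ⁻¹' U, hU.preimage hp.continuous, fun x hx => hBU (hP hx), G ∘ p,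
    hG.comp hp.contDiffOn (mapsTo_preimage _ _), fun x hx => ?_⟩
  simp only [Function.comp_apply]
  exact hGg (hP hx)

variable (k : Type*) [CommRing k] [Algebra k ℝ]

/-- **`C¹` cells** [Dries1998, Ch. 7 (3.1)(2)]: as `IsSACell`, but the sections defining graphs and
bands are `C¹` on their cells (besides continuous and `k`-semialgebraic).
[cite: Dries1998, Ch. 7 (3.1)] -/
inductive IsC1SACell : (n d : ℕ) → Set (Fin n → ℝ) → Prop
  | zero : IsC1SACell 0 0 univ
  | graph {n d : ℕ} {S : Set (Fin n → ℝ)} {f : (Fin n → ℝ) → ℝ} :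
      IsC1SACell n d S → ContinuousOn f S → IsSemialgebraicFunOn k S f → IsC1On f S →
        IsC1SACell (n + 1) d (graphOver S f)
  | band {n d l : ℕ} {S : Set (Fin n → ℝ)} {ξ : Fin l → (Fin n → ℝ) → ℝ} (j : Fin (l + 1)) :
      IsC1SACell n d S → (∀ i, ContinuousOn (ξ i) S) → (∀ i, IsSemialgebraicFunOn k S (ξ i)) →
        (∀ i, IsC1On (ξ i) S) → (∀ x ∈ S, StrictMono fun i => ξ i x) →
          IsC1SACell (n + 1) (d + 1) (bandOver S ξ j)

variable {k}

/-- `C¹` cells are cells. [cite: Dries1998, Ch. 7 (3.1)] -/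
theorem IsC1SACell.isSACell {n d : ℕ} {C : Set (Fin n → ℝ)} (h : IsC1SACell k n d C) :
    IsSACell k n d C := by
  induction h with
  | zero => exact IsSACell.zero
  | graph _ hc hs _ ih => exact ih.graph hc hs
  | band j _ hc hs _ hm ih => exact IsSACell.band j ih hc hs hm

/-- `k`-`C¹` cells are real `C¹` cells. [folklore] -/
theorem IsC1SACell.real {n d : ℕ} {C : Set (Fin n → ℝ)} (h : IsC1SACell k n d C) :
    IsC1SACell ℝ n d C := by
  induction h with
  | zero => exact IsC1SACell.zero
  | graph _ hc hs h1 ih => exact ih.graph hc hs.real_of h1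
  | band j _ hc hs h1 hm ih => exact IsC1SACell.band j ih hc (fun i => (hs i).real_of) h1 hm

/-- `Fin.snoc` of `C¹` maps is `C¹`. [folklore] -/
theorem ContDiffOn.finSnoc' {m d : ℕ} {U : Set (Fin d → ℝ)} {φ : (Fin d → ℝ) → (Fin m → ℝ)}
    {g : (Fin d → ℝ) → ℝ} (hφ : ContDiffOn ℝ 1 φ U) (hg : ContDiffOn ℝ 1 g U) :
    ContDiffOn ℝ 1 (fun u => (Fin.snoc (φ u) (g u) : Fin (m + 1) → ℝ)) U := by
  refine contDiffOn_pi.mpr fun l => ?_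
  refine Fin.lastCases ?_ (fun i => ?_) l
  · simp only [Fin.snoc_last]
    exact hg
  · simp only [Fin.snoc_castSucc]
    exact contDiffOn_pi.mp hφ i

/-- **`C¹` charts of `C¹` cells** [Dries1998, Ch. 7 (3.1) with Ch. 3 (2.7)]: the chart of
`IsSACell.exists_chart` has a `C¹` inverse `φ` when the cell is a `C¹` cell.
[cite: Dries1998, Ch. 7 (3.1)] -/
theorem IsC1SACell.exists_c1_chart {n d : ℕ} {C : Set (Fin n → ℝ)} (h : IsC1SACell k n d C) :
    ∃ (ι : Fin d → Fin n) (U : Set (Fin d → ℝ)) (φ : (Fin d → ℝ) → (Fin n → ℝ)),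
      StrictMono ι ∧ IsSACell k d d U ∧ U = (fun x : Fin n → ℝ => x ∘ ι) '' C ∧
      ContinuousOn φ U ∧ IsSemialgebraicMapOn k U φ ∧ ContDiffOn ℝ 1 φ U ∧
      (∀ x ∈ C, φ (x ∘ ι) = x) ∧ (∀ u ∈ U, φ u ∈ C ∧ (φ u) ∘ ι = u) := by
  induction h with
  | zero =>
    refine ⟨fun i => i, univ, id, fun a _ _ => a.elim0, IsSACell.zero, ?_, continuousOn_id,
      Literature.NumberTheory.Transcendental.isSemialgebraicMapOn_id isSemialgebraic_univ,
      contDiffOn_id, fun x _ => Subsingleton.elim _ _, fun u _ => ⟨mem_univ _, Subsingleton.elim _ _⟩⟩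
    ext u
    exact ⟨fun _ => ⟨u, mem_univ _, Subsingleton.elim _ _⟩, fun _ => mem_univ _⟩
  | @graph n d S f hS hfc hfs hf1 ih =>
    obtain ⟨ι, U, φ, hι, hU, hUeq, hφc, hφs, hφ1, hleft, hright⟩ := ih
    have hUs : IsSemialgebraic k U := hU.isSemialgebraic
    have hUo : IsOpen U := hU.isOpen rfl
    have hφS : MapsTo φ U S := fun u hu => (hright u hu).1
    refine ⟨fun i => Fin.castSucc (ι i), U, fun u => Fin.snoc (φ u) (f (φ u)),
      fun a b hab => by simpa using hι hab, hU, ?_, ?_, ?_, ?_, ?_, ?_⟩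
    · -- U = image
      rw [hUeq]
      ext u
      constructor
      · rintro ⟨x, hx, rfl⟩
        refine ⟨Fin.snoc x (f x), ⟨by simpa using hx, by simp⟩, ?_⟩
        beta_reduce
        rw [comp_castSuccIdx, Fin.init_snoc]
      · rintro ⟨z, hz, rfl⟩
        refine ⟨Fin.init z, hz.1, ?_⟩
        beta_reduce
        rw [comp_castSuccIdx]
    · exact hφc.finSnoc (hfc.comp hφc hφS)
    · refine IsSemialgebraicMapOn.of_forall hUs fun l => ?_
      refine Fin.lastCases ?_ (fun i => ?_) l
      · simp only [Fin.snoc_last]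
        exact IsSemialgebraicFunOn.comp_isSemialgebraicMapOn_holds hfs hφs hφS
      · simp only [Fin.snoc_castSucc]
        exact (Literature.NumberTheory.Transcendental.isSemialgebraicMapOn_iff_forall_holds hUs).mp
          hφs i
    · -- C¹
      obtain ⟨O, hO, hSO, F, hF, hFf⟩ := hf1
      have hcomp : ContDiffOn ℝ 1 (fun u => F (φ u)) U := hF.comp hφ1 fun u hu => hSO (hφS hu)
      have hcomp' : ContDiffOn ℝ 1 (fun u => f (φ u)) U :=
        hcomp.congr fun u hu => (hFf (hφS hu)).symm
      exact ContDiffOn.finSnoc' hφ1 hcomp'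
    · intro z hz
      beta_reduce
      rw [comp_castSuccIdx, hleft _ hz.1, ← hz.2, Fin.snoc_init_self]
    · intro u hu
      refine ⟨⟨by simpa using hφS hu, by simp⟩, ?_⟩
      beta_reduce
      rw [comp_castSuccIdx, Fin.init_snoc, (hright u hu).2]
  | @band n d l S ξ j hS hξc hξs hξ1 hmono ih =>
    obtain ⟨ι, U, φ, hι, hU, hUeq, hφc, hφs, hφ1, hleft, hright⟩ := ih
    have hUs : IsSemialgebraic k U := hU.isSemialgebraic
    have hφS : MapsTo φ U S := fun u hu => (hright u hu).1
    set ι' : Fin (d + 1) → Fin (n + 1) := Fin.snoc (fun i => Fin.castSucc (ι i)) (Fin.last n) with hι'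
    set U' : Set (Fin (d + 1) → ℝ) := bandOver U (fun i => ξ i ∘ φ) j with hU'
    have hξφc : ∀ i, ContinuousOn (ξ i ∘ φ) U := fun i => (hξc i).comp hφc hφS
    have hξφs : ∀ i, IsSemialgebraicFunOn k U (ξ i ∘ φ) := fun i =>
      IsSemialgebraicFunOn.comp_isSemialgebraicMapOn_holds (hξs i) hφs hφS
    have hU'cell : IsSACell k (d + 1) (d + 1) U' :=
      IsSACell.band j hU hξφc hξφs fun u hu => hmono _ (hφS hu)
    have hU's : IsSemialgebraic k U' := hU'cell.isSemialgebraic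
    have hU'o : IsOpen U' := hU'cell.isOpen rfl
    have hinit : ∀ w ∈ U', Fin.init w ∈ U := fun w hw => hw.1
    refine ⟨ι', U', fun w => Fin.snoc (φ (Fin.init w)) (w (Fin.last d)), strictMono_snocIdx hι,
      hU'cell, ?_, ?_, ?_, ?_, ?_, ?_⟩
    · ext w
      constructor
      · intro hw
        obtain ⟨hwU, hlo, hup⟩ := hw
        obtain ⟨hxS, hxι⟩ := hright _ hwU
        refine ⟨Fin.snoc (φ (Fin.init w)) (w (Fin.last d)), ⟨by simpa using hxS, ?_, ?_⟩, ?_⟩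
        · simpa [bandLower_comp] using hlo
        · simpa [bandUpper_comp] using hup
        · beta_reduce
          rw [comp_snocIdx, Fin.init_snoc, Fin.snoc_last, hxι, Fin.snoc_init_self]
      · rintro ⟨z, hz, rfl⟩
        obtain ⟨hzS, hlo, hup⟩ := hz
        beta_reduce
        rw [comp_snocIdx]
        refine ⟨?_, ?_, ?_⟩
        · show Fin.init (Fin.snoc (Fin.init z ∘ ι) (z (Fin.last n)) : Fin (d + 1) → ℝ) ∈ U
          rw [Fin.init_snoc, hUeq]
          exact ⟨Fin.init z, hzS, rfl⟩
        · simp only [Fin.init_snoc, Fin.snoc_last, bandLower_comp, hleft _ hzS]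
          exact hlo
        · simp only [Fin.init_snoc, Fin.snoc_last, bandUpper_comp, hleft _ hzS]
          exact hup
    · have h1 : ContinuousOn (fun w : Fin (d + 1) → ℝ => φ (Fin.init w)) U' :=
        hφc.comp continuous_id.finInit.continuousOn hinit
      have h2 : ContinuousOn (fun w : Fin (d + 1) → ℝ => w (Fin.last d)) U' :=
        (continuous_apply _).continuousOn
      exact h1.finSnoc h2
    · refine IsSemialgebraicMapOn.of_forall hU's fun l' => ?_
      refine Fin.lastCases ?_ (fun i => ?_) l'
      · simp only [Fin.snoc_last]
        exact isSemialgebraicFunOn_apply hU's (Fin.last d)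
      · simp only [Fin.snoc_castSucc]
        have hφi : IsSemialgebraicFunOn k U (fun u => φ u i) :=
          (Literature.NumberTheory.Transcendental.isSemialgebraicMapOn_iff_forall_holds hUs).mp hφs i
        exact hφi.comp_init.mono hinit hU's
    · -- C¹
      have hinitC : ContDiff ℝ 1 fun w : Fin (d + 1) → ℝ => Fin.init w :=
        contDiff_pi.mpr fun i => contDiff_apply ℝ ℝ (Fin.castSucc i)
      have h1 : ContDiffOn ℝ 1 (fun w : Fin (d + 1) → ℝ => φ (Fin.init w)) U' :=
        hφ1.comp hinitC.contDiffOn hinit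
      have h2 : ContDiffOn ℝ 1 (fun w : Fin (d + 1) → ℝ => w (Fin.last d)) U' :=
        (contDiff_apply ℝ ℝ (Fin.last d)).contDiffOn
      exact ContDiffOn.finSnoc' h1 h2
    · intro z hz
      have hzS : Fin.init z ∈ S := hz.1
      beta_reduce
      rw [comp_snocIdx, Fin.init_snoc, Fin.snoc_last, hleft _ hzS, Fin.snoc_init_self]
    · intro w hw
      obtain ⟨hwU, hlo, hup⟩ := hw
      obtain ⟨hxS, hxι⟩ := hright _ hwU
      refine ⟨⟨by simpa using hxS, ?_, ?_⟩, ?_⟩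
      · simpa [bandLower_comp] using hlo
      · simpa [bandUpper_comp] using hup
      · beta_reduce
        rw [comp_snocIdx, Fin.init_snoc, Fin.snoc_last, hxι, Fin.snoc_init_self]

end C1Cells

section StackRefinement

variable {n : ℕ}

/-- Restricting a graph to a smaller base is intersecting with the cylinder over it. [folklore] -/
theorem graphOver_inter_cylinder {S E : Set (Fin n → ℝ)} (hES : E ⊆ S) (f : (Fin n → ℝ) → ℝ) :
    graphOver E f = graphOver S f ∩ {z | Fin.init z ∈ E} := by
  ext z
  simp only [mem_graphOver_iff, mem_inter_iff, mem_setOf_eq]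
  constructor
  · rintro ⟨h1, h2⟩
    exact ⟨⟨hES h1, h2⟩, h1⟩
  · rintro ⟨⟨-, h2⟩, h1⟩
    exact ⟨h1, h2⟩

/-- Restricting a band to a smaller base is intersecting with the cylinder over it. [folklore] -/
theorem bandOver_inter_cylinder {l : ℕ} {S E : Set (Fin n → ℝ)} (hES : E ⊆ S)
    (ξ : Fin l → (Fin n → ℝ) → ℝ) (j : Fin (l + 1)) :
    bandOver E ξ j = bandOver S ξ j ∩ {z | Fin.init z ∈ E} := by
  ext z
  simp only [mem_bandOver_iff, mem_inter_iff, mem_setOf_eq]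
  constructor
  · rintro ⟨h1, h2⟩
    exact ⟨⟨hES h1, h2⟩, h1⟩
  · rintro ⟨⟨-, h2⟩, h1⟩
    exact ⟨h1, h2⟩

/-- **Refining a stack over a refined base** (the step "`π(𝒟)` refined, and `𝒟` accordingly" of
[Dries1998, Ch. 7 (3.2), proof of `(I_{m+1})`]): a cylindrical decomposition of `ℝⁿ⁺¹`, given as
the stack of sections `ξ_S` over a decomposition `𝒟'` of `ℝⁿ`, induces over any decomposition `ℰ'`
of `ℝⁿ` partitioning the cells of `𝒟'` the stack of the restricted sections, which is a cylindrical
decomposition of `ℝⁿ⁺¹` refining the given one. [cite: Dries1998, Ch. 7 (3.2)] -/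
theorem exists_refined_stack {𝒟 : Finset (Set (Fin (n + 1) → ℝ))}
    (h𝒟 : IsCylindricalDecomposition ℝ (n + 1) 𝒟) {𝒟' : Finset (Set (Fin n → ℝ))}
    (h𝒟' : IsCylindricalDecomposition ℝ n 𝒟') {l : Set (Fin n → ℝ) → ℕ}
    {ξ : (S : Set (Fin n → ℝ)) → Fin (l S) → (Fin n → ℝ) → ℝ}
    (hcont : ∀ S ∈ 𝒟', ∀ j, ContinuousOn (ξ S j) S)
    (hsa : ∀ S ∈ 𝒟', ∀ j, IsSemialgebraicFunOn ℝ S (ξ S j))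
    (hmono : ∀ S ∈ 𝒟', ∀ x ∈ S, StrictMono fun j => ξ S j x)
    (hmem : ∀ T, T ∈ 𝒟 ↔ ∃ S ∈ 𝒟', (∃ j, T = graphOver S (ξ S j)) ∨ ∃ j, T = bandOver S (ξ S) j)
    {ℰ' : Finset (Set (Fin n → ℝ))} (hℰ' : IsCylindricalDecomposition ℝ n ℰ')
    (href : ∀ S ∈ 𝒟', ∀ E ∈ ℰ', E ⊆ S ∨ Disjoint E S) :
    ∃ (Sf : Set (Fin n → ℝ) → Set (Fin n → ℝ)) (ℰ : Finset (Set (Fin (n + 1) → ℝ))),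
      (∀ E ∈ ℰ', Sf E ∈ 𝒟' ∧ E ⊆ Sf E) ∧
      IsCylindricalDecomposition ℝ (n + 1) ℰ ∧
      (∀ T', T' ∈ ℰ ↔ ∃ E ∈ ℰ', (∃ j, T' = graphOver E (ξ (Sf E) j)) ∨ ∃ j, T' = bandOver E (ξ (Sf E)) j) ∧
      (∀ T ∈ 𝒟, ∀ T' ∈ ℰ, T' ⊆ T ∨ Disjoint T' T) ∧
      (∀ T ∈ 𝒟, ∀ z ∈ T, ∃ T' ∈ ℰ, z ∈ T' ∧ T' ⊆ T) := by
  classical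
  have hpart' := h𝒟'.isPartition
  have hpartE := hℰ'.isPartition
  have hpart := h𝒟.isPartition
  -- the base cell of `𝒟'` containing a cell of `ℰ'`
  have hSf : ∀ E ∈ ℰ', ∃ S ∈ 𝒟', E ⊆ S := by
    intro E hE
    have hEne : E.Nonempty := nonempty_iff_ne_empty.mpr fun h => hpartE.1 (h ▸ hE)
    obtain ⟨x, hx⟩ := hEne
    obtain ⟨S, ⟨hS, hxS⟩, -⟩ := hpart'.2 x
    rcases href S hS E hE with h | h
    · exact ⟨S, hS, h⟩
    · exact absurd (Set.disjoint_left.mp h hx) (not_not.mpr hxS)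
  choose! Sf hSf𝒟 hESf using hSf
  -- uniqueness of the base cell
  have hSf_eq : ∀ E ∈ ℰ', ∀ S ∈ 𝒟', ∀ x ∈ E, x ∈ S → Sf E = S := fun E hE S hS x hxE hxS =>
    hpart'.eq_of_mem_of_mem (hSf𝒟 E hE) hS (hESf E hE hxE) hxS
  -- the refined stack
  let cellsOver : Set (Fin n → ℝ) → Finset (Set (Fin (n + 1) → ℝ)) := fun E =>
    (Finset.univ.image fun j : Fin (l (Sf E)) => graphOver E (ξ (Sf E) j)) ∪
      (Finset.univ.image fun j : Fin (l (Sf E) + 1) => bandOver E (ξ (Sf E)) j)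
  set ℰ : Finset (Set (Fin (n + 1) → ℝ)) := ℰ'.biUnion cellsOver with hℰ
  have hmemℰ : ∀ T', T' ∈ ℰ ↔ ∃ E ∈ ℰ', (∃ j, T' = graphOver E (ξ (Sf E) j)) ∨
      ∃ j, T' = bandOver E (ξ (Sf E)) j := by
    intro T'
    simp only [hℰ, Finset.mem_biUnion, cellsOver, Finset.mem_union, Finset.mem_image,
      Finset.mem_univ, true_and]
    constructor
    · rintro ⟨E, hE, h | h⟩
      · obtain ⟨j, hj⟩ := h
        exact ⟨E, hE, Or.inl ⟨j, hj.symm⟩⟩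
      · obtain ⟨j, hj⟩ := h
        exact ⟨E, hE, Or.inr ⟨j, hj.symm⟩⟩
    · rintro ⟨E, hE, h | h⟩
      · obtain ⟨j, hj⟩ := h
        exact ⟨E, hE, Or.inl ⟨j, hj.symm⟩⟩
      · obtain ⟨j, hj⟩ := h
        exact ⟨E, hE, Or.inr ⟨j, hj.symm⟩⟩
  -- every refined cell is `X ∩ cylinder(E)` for a cell `X ∈ 𝒟` over `Sf E`
  have hparent : ∀ T' ∈ ℰ, ∃ E ∈ ℰ', ∃ X ∈ 𝒟, T' = X ∩ {z | Fin.init z ∈ E} ∧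
      ∀ z ∈ X, Fin.init z ∈ Sf E := by
    intro T' hT'
    obtain ⟨E, hE, h | h⟩ := (hmemℰ T').mp hT'
    · obtain ⟨j, rfl⟩ := h
      refine ⟨E, hE, graphOver (Sf E) (ξ (Sf E) j), (hmem _).mpr ⟨Sf E, hSf𝒟 E hE, Or.inl ⟨j, rfl⟩⟩,
        graphOver_inter_cylinder (hESf E hE) _, fun z hz => hz.1⟩
    · obtain ⟨j, rfl⟩ := h
      refine ⟨E, hE, bandOver (Sf E) (ξ (Sf E)) j, (hmem _).mpr ⟨Sf E, hSf𝒟 E hE, Or.inr ⟨j, rfl⟩⟩,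
        bandOver_inter_cylinder (hESf E hE) _ _, fun z hz => hz.1⟩
  -- conversely `X ∩ cylinder(E) ∈ ℰ` for `X ∈ 𝒟` over `S ⊇ E`
  have hchild : ∀ X ∈ 𝒟, ∀ E ∈ ℰ', ∀ z ∈ X, Fin.init z ∈ E → X ∩ {z | Fin.init z ∈ E} ∈ ℰ := by
    intro X hX E hE z hzX hzE
    obtain ⟨S, hS, h⟩ := (hmem X).mp hX
    have hxS : Fin.init z ∈ S := by
      rcases h with ⟨j, rfl⟩ | ⟨j, rfl⟩
      · exact hzX.1
      · exact hzX.1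
    have hSfE : Sf E = S := hSf_eq E hE S hS _ hzE hxS
    rcases h with ⟨j, rfl⟩ | ⟨j, rfl⟩
    · refine (hmemℰ _).mpr ⟨E, hE, Or.inl ?_⟩
      subst hSfE
      exact ⟨j, (graphOver_inter_cylinder (hESf E hE) _).symm⟩
    · refine (hmemℰ _).mpr ⟨E, hE, Or.inr ?_⟩
      subst hSfE
      exact ⟨j, (bandOver_inter_cylinder (hESf E hE) _ _).symm⟩
  -- nonemptiness of the refined cells
  have hne : ∀ T' ∈ ℰ, T'.Nonempty := by
    intro T' hT'
    obtain ⟨E, hE, h | h⟩ := (hmemℰ T').mp hT'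
    · obtain ⟨j, rfl⟩ := h
      have hEne : E.Nonempty := nonempty_iff_ne_empty.mpr fun h => hpartE.1 (h ▸ hE)
      obtain ⟨x, hx⟩ := hEne
      exact ⟨Fin.snoc x (ξ (Sf E) j x), by simp [hx]⟩
    · obtain ⟨j, rfl⟩ := h
      have hEne : E.Nonempty := nonempty_iff_ne_empty.mpr fun h => hpartE.1 (h ▸ hE)
      obtain ⟨x, hx⟩ := hEne
      have hc : ∀ i, ContinuousOn (ξ (Sf E) i) E := fun i =>
        (hcont _ (hSf𝒟 E hE) i).mono (hESf E hE)
      have hm : ∀ y ∈ E, StrictMono fun i => ξ (Sf E) i y := fun y hy =>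
        hmono _ (hSf𝒟 E hE) y (hESf E hE hy)
      obtain ⟨m, -, hm'⟩ := exists_continuousOn_snoc_mem_bandOver hc hm j
      exact ⟨_, hm' x hx⟩
  -- refinement
  have hrefine : ∀ T ∈ 𝒟, ∀ T' ∈ ℰ, T' ⊆ T ∨ Disjoint T' T := by
    intro T hT T' hT'
    obtain ⟨E, hE, X, hX, hT'eq, -⟩ := hparent T' hT'
    by_cases hXT : X = T
    · left
      rw [hT'eq, hXT]
      exact inter_subset_left
    · right
      rw [hT'eq]
      exact Set.disjoint_of_subset_left inter_subset_left (hpart.pairwiseDisjoint hX hT hXT)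
  have hcover : ∀ T ∈ 𝒟, ∀ z ∈ T, ∃ T' ∈ ℰ, z ∈ T' ∧ T' ⊆ T := by
    intro T hT z hz
    obtain ⟨E, ⟨hE, hzE⟩, -⟩ := hpartE.2 (Fin.init z)
    exact ⟨_, hchild T hT E hE z hz hzE, ⟨hz, hzE⟩, inter_subset_left⟩
  refine ⟨Sf, ℰ, fun E hE => ⟨hSf𝒟 E hE, hESf E hE⟩, ?_, hmemℰ, hrefine, hcover⟩
  -- the refined stack is a cylindrical decomposition
  rw [isCylindricalDecomposition_succ]
  refine ⟨⟨fun h => ?_, fun z => ?_⟩, fun T' hT' => ?_, ℰ', hℰ', ?_⟩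
  · exact not_nonempty_empty (hne ∅ h)
  · -- existence and uniqueness of the cell through `z`
    obtain ⟨T, ⟨hT, hzT⟩, -⟩ := hpart.2 z
    obtain ⟨T', hT', hzT', -⟩ := hcover T hT z hzT
    refine ⟨T', ⟨hT', hzT'⟩, fun T'' ⟨hT'', hzT''⟩ => ?_⟩
    obtain ⟨E₁, hE₁, X₁, hX₁, h₁, -⟩ := hparent T' hT'
    obtain ⟨E₂, hE₂, X₂, hX₂, h₂, -⟩ := hparent T'' hT''
    rw [h₁] at hzT' ⊢
    rw [h₂] at hzT''
    rw [h₂]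
    have hX : X₁ = X₂ := hpart.eq_of_mem_of_mem hX₁ hX₂ hzT'.1 hzT''.1
    have hEE : E₁ = E₂ := hpartE.eq_of_mem_of_mem hE₁ hE₂ hzT'.2 hzT''.2
    rw [hX, hEE]
  · -- semialgebraicity
    obtain ⟨E, hE, h | h⟩ := (hmemℰ T').mp hT'
    · obtain ⟨j, rfl⟩ := h
      exact isSemialgebraicFunOn_iff_isSemialgebraic_graphOver.mp
        ((hsa _ (hSf𝒟 E hE) j).mono (hESf E hE) (hℰ'.isSemialgebraic E hE))
    · obtain ⟨j, rfl⟩ := h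
      exact isSemialgebraic_bandOver' (hℰ'.isSemialgebraic E hE)
        (fun i => (hsa _ (hSf𝒟 E hE) i).mono (hESf E hE) (hℰ'.isSemialgebraic E hE)) j
  · -- the stack structure
    refine ⟨fun E => l (Sf E), fun E => ξ (Sf E), fun E hE j => (hcont _ (hSf𝒟 E hE) j).mono (hESf E hE),
      fun E hE j => (hsa _ (hSf𝒟 E hE) j).mono (hESf E hE) (hℰ'.isSemialgebraic E hE),
      fun E hE x hx => hmono _ (hSf𝒟 E hE) x (hESf E hE hx), hmemℰ⟩

end StackRefinement

section C1Decomposition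

variable {m : ℕ}

/-- **`C¹` cylindrical decompositions**: cylindrical decompositions of `ℝᵐ` all of whose cells are
(real) `C¹` cells. [cite: Dries1998, Ch. 7 (3.1)] -/
def IsC1CAD (m : ℕ) (𝒟 : Finset (Set (Fin m → ℝ))) : Prop :=
  IsCylindricalDecomposition ℝ m 𝒟 ∧ ∀ C ∈ 𝒟, ∃ d, IsC1SACell ℝ m d C

/-- Nonempty cells of a decomposition lie in a cell of any coarser decomposition. [folklore] -/
theorem exists_superset_of_refines {𝒟 ℰ : Finset (Set (Fin m → ℝ))}
    (h𝒟 : IsCylindricalDecomposition ℝ m 𝒟) (href : ∀ T ∈ 𝒟, ∀ T' ∈ ℰ, T' ⊆ T ∨ Disjoint T' T)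
    {T' : Set (Fin m → ℝ)} (hT' : T' ∈ ℰ) (hne : T'.Nonempty) : ∃ T ∈ 𝒟, T' ⊆ T := by
  obtain ⟨z, hz⟩ := hne
  obtain ⟨T, ⟨hT, hzT⟩, -⟩ := h𝒟.isPartition.2 z
  rcases href T hT T' hT' with h | h
  · exact ⟨T, hT, h⟩
  · exact absurd (Set.disjoint_left.mp h hz) (not_not.mpr hzT)

/-- `subset ∨ disjoint` transfers along inclusions. [folklore] -/
theorem subset_or_disjoint_of_subset {C T A : Set (Fin m → ℝ)} (hCT : C ⊆ T)
    (h : T ⊆ A ∨ Disjoint T A) : C ⊆ A ∨ Disjoint C A := by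
  rcases h with h | h
  · exact Or.inl (hCT.trans h)
  · exact Or.inr (Set.disjoint_of_subset_left hCT h)

/-- Cells of a cylindrical decomposition are nonempty. [cite: BasuPollackRoy2006, Def. 5.1] -/
theorem IsCylindricalDecomposition.nonempty_of_mem {𝒟 : Finset (Set (Fin m → ℝ))}
    (h𝒟 : IsCylindricalDecomposition ℝ m 𝒟) {C : Set (Fin m → ℝ)} (hC : C ∈ 𝒟) : C.Nonempty :=
  nonempty_iff_ne_empty.mpr fun h => h𝒟.isPartition.1 (h ▸ hC)

/-- **The `C¹` cell decomposition theorem** [Dries1998, Ch. 7 (3.2)], semialgebraic over `ℝ`, both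
clauses at once:
`(I_m)` every finite family of semialgebraic subsets of `ℝᵐ` is partitioned by a cylindrical
decomposition into `C¹` cells;
`(II_m)` for finitely many semialgebraic functions `fᵢ` on semialgebraic `Aᵢ ⊆ ℝᵐ` there is such a
decomposition partitioning the `Aᵢ` (and a given finite family) with every `fᵢ` of class `C¹` on
each cell contained in `Aᵢ`.
Proof as printed, with `(III_m)` replaced by generic smoothness
(`IsSemialgebraicFunOn.exists_contDiffOn_holds`). [cite: Dries1998, Ch. 7 (3.2)] -/
theorem c1_cell_decomposition : ∀ m : ℕ,
    (∀ 𝒜 : Finset (Set (Fin m → ℝ)), (∀ A ∈ 𝒜, IsSemialgebraic ℝ A) →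
      ∃ 𝒟 : Finset (Set (Fin m → ℝ)), IsC1CAD m 𝒟 ∧ ∀ A ∈ 𝒜, ∀ C ∈ 𝒟, C ⊆ A ∨ Disjoint C A) ∧
    (∀ (ι : Type) [Fintype ι] (A : ι → Set (Fin m → ℝ)) (f : ι → (Fin m → ℝ) → ℝ),
      (∀ i, IsSemialgebraicFunOn ℝ (A i) (f i)) →
      ∀ 𝒜 : Finset (Set (Fin m → ℝ)), (∀ B ∈ 𝒜, IsSemialgebraic ℝ B) →
        ∃ 𝒟 : Finset (Set (Fin m → ℝ)), IsC1CAD m 𝒟 ∧ (∀ B ∈ 𝒜, ∀ C ∈ 𝒟, C ⊆ B ∨ Disjoint C B) ∧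
          (∀ i, ∀ C ∈ 𝒟, C ⊆ A i ∨ Disjoint C (A i)) ∧ ∀ i, ∀ C ∈ 𝒟, C ⊆ A i → IsC1On (f i) C) := by
  intro m
  induction m using Nat.strong_induction_on with
  | _ m IH =>
  classical
  -- (I_m)
  have hI : ∀ 𝒜 : Finset (Set (Fin m → ℝ)), (∀ A ∈ 𝒜, IsSemialgebraic ℝ A) →
      ∃ 𝒟 : Finset (Set (Fin m → ℝ)), IsC1CAD m 𝒟 ∧ ∀ A ∈ 𝒜, ∀ C ∈ 𝒟, C ⊆ A ∨ Disjoint C A := by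
    intro 𝒜 h𝒜
    cases m with
    | zero =>
      refine ⟨{univ}, ⟨isCylindricalDecomposition_zero.mpr rfl, fun C hC => ?_⟩, fun A _ C hC => ?_⟩
      · rw [Finset.mem_singleton] at hC
        subst hC
        exact ⟨0, IsC1SACell.zero⟩
      · rw [Finset.mem_singleton] at hC
        subst hC
        rcases A.eq_empty_or_nonempty with rfl | ⟨a, ha⟩
        · exact Or.inr (disjoint_empty _)
        · exact Or.inl fun x _ => (Subsingleton.elim a x) ▸ ha
    | succ m' =>
      -- an ordinary decomposition adapted to `𝒜`, as a stack over `𝒟'`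
      obtain ⟨𝒟, h𝒟, hadapt⟩ := IsSemialgebraic.exists_cylindricalDecomposition_holds (k := ℝ) 𝒜 h𝒜
      obtain ⟨𝒟', h𝒟', l, ξ, hcont, hsa, hmono, hmem⟩ := h𝒟.exists_isCylinderStack
      -- make the sections `C¹` on a refinement of the base (II_{m'})
      obtain ⟨-, hII'⟩ := IH m' (Nat.lt_succ_self m')
      let ι : Type := Σ S : {S // S ∈ 𝒟'}, Fin (l S.1)
      obtain ⟨ℰ', ⟨hℰ', hℰ'cell⟩, hℰ'𝒟', hℰ'A, hℰ'f⟩ := hII' ι (fun p => p.1.1) (fun p => ξ p.1.1 p.2)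
        (fun p => hsa p.1.1 p.1.2 p.2) 𝒟' (h𝒟'.isSemialgebraic)
      obtain ⟨Sf, ℰ, hSf, hℰ, hmemℰ, href, -⟩ := exists_refined_stack h𝒟 h𝒟' hcont hsa hmono hmem
        hℰ' (fun S hS E hE => hℰ'𝒟' S hS E hE)
      refine ⟨ℰ, ⟨hℰ, fun T' hT' => ?_⟩, fun A hA T' hT' => ?_⟩
      · -- the refined cells are `C¹` cells
        obtain ⟨E, hE, h⟩ := (hmemℰ T').mp hT'
        obtain ⟨d, hEcell⟩ := hℰ'cell E hE
        have hSE := hSf E hE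
        have hc : ∀ j, ContinuousOn (ξ (Sf E) j) E := fun j => (hcont _ hSE.1 j).mono hSE.2
        have hs : ∀ j, IsSemialgebraicFunOn ℝ E (ξ (Sf E) j) := fun j =>
          (hsa _ hSE.1 j).mono hSE.2 (hℰ'.isSemialgebraic E hE)
        have h1 : ∀ j, IsC1On (ξ (Sf E) j) E := fun j =>
          hℰ'f ⟨⟨Sf E, hSE.1⟩, j⟩ E hE hSE.2
        rcases h with ⟨j, rfl⟩ | ⟨j, rfl⟩
        · exact ⟨d, hEcell.graph (hc j) (hs j) (h1 j)⟩
        · exact ⟨d + 1, IsC1SACell.band j hEcell hc hs h1 fun x hx => hmono _ hSE.1 x (hSE.2 hx)⟩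
      · -- adaptedness to `𝒜`
        obtain ⟨T, hT, hT'T⟩ := exists_superset_of_refines h𝒟 href hT' (hℰ.nonempty_of_mem hT')
        exact subset_or_disjoint_of_subset hT'T (h𝒟.subset_or_disjoint (hadapt A hA) hT)
  refine ⟨hI, ?_⟩
  -- (II_m)
  intro ι _ A f hf 𝒜 h𝒜
  -- generic smoothness on the interiors
  have hsmooth : ∀ i, ∃ Z : Set (Fin m → ℝ), Z ⊆ interior (A i) ∧ IsSemialgebraic ℝ Z ∧
      interior Z = ∅ ∧ IsOpen (interior (A i) \ Z) ∧ ContDiffOn ℝ ∞ (f i) (interior (A i) \ Z) :=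
    fun i => IsSemialgebraicFunOn.exists_contDiffOn_holds (k := ℝ) isOpen_interior
      ((hf i).mono interior_subset (isSemialgebraic_interior (IsSemialgebraicFunOn.isSemialgebraic_holds (hf i))))
  choose Z hZA hZs hZint hZopen hZsmooth using hsmooth
  have hAs : ∀ i, IsSemialgebraic ℝ (A i) := fun i => IsSemialgebraicFunOn.isSemialgebraic_holds (hf i)
  -- first decomposition
  set 𝒜₁ : Finset (Set (Fin m → ℝ)) := 𝒜 ∪ Finset.univ.image A ∪
    Finset.univ.image (fun i => interior (A i) \ Z i) with h𝒜₁
  have h𝒜₁ : ∀ B ∈ 𝒜₁, IsSemialgebraic ℝ B := by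
    intro B hB
    rcases Finset.mem_union.mp hB with hB | hB
    · rcases Finset.mem_union.mp hB with hB | hB
      · exact h𝒜 B hB
      · obtain ⟨i, -, rfl⟩ := Finset.mem_image.mp hB
        exact hAs i
    · obtain ⟨i, -, rfl⟩ := Finset.mem_image.mp hB
      exact (isSemialgebraic_interior (hAs i)).diff (hZs i)
  obtain ⟨𝒟, ⟨h𝒟, h𝒟cell⟩, h𝒟adapt⟩ := hI 𝒜₁ h𝒜₁
  -- the pieces of each cell on which `f i` is `C¹`
  have hpieces : ∀ C ∈ 𝒟, ∀ i, C ⊆ A i → ∃ Pc : Finset (Set (Fin m → ℝ)),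
      (∀ P ∈ Pc, IsSemialgebraic ℝ P ∧ IsC1On (f i) P) ∧ C ⊆ ⋃ P ∈ Pc, P := by
    intro C hC i hCA
    obtain ⟨d, hcell⟩ := h𝒟cell C hC
    by_cases hd : d = m
    · -- open cell: inside `interior (A i) ∖ Z i`
      subst hd
      have hCo : IsOpen C := hcell.isSACell.isOpen rfl
      have hCint : C ⊆ interior (A i) := interior_maximal hCA hCo
      have hmemZ : interior (A i) \ Z i ∈ 𝒜₁ :=
        Finset.mem_union_right _ (Finset.mem_image.mpr ⟨i, Finset.mem_univ _, rfl⟩)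
      have hCZ : C ⊆ interior (A i) \ Z i := by
        rcases h𝒟adapt _ hmemZ C hC with h | h
        · exact h
        · exfalso
          have hCZ' : C ⊆ Z i := fun x hx => by
            by_contra hxZ
            exact Set.disjoint_left.mp h hx ⟨hCint hx, hxZ⟩
          have := interior_mono hCZ'
          rw [hZint i, hCo.interior_eq] at this
          exact not_nonempty_empty ((h𝒟.nonempty_of_mem hC).mono this)
      refine ⟨{C}, fun P hP => ?_, by simp⟩
      rw [Finset.mem_singleton] at hP
      subst hP
      exact ⟨h𝒟.isSemialgebraic _ hC,
        IsC1On.of_contDiffOn (hZopen i) ((hZsmooth i).of_le (by exact_mod_cast le_top)) hCZ⟩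
    · -- lower-dimensional cell: through the `C¹` chart and `(II_d)`
      have hdm : d < m := lt_of_le_of_ne hcell.isSACell.le hd
      obtain ⟨ιC, U, φ, hιC, hU, hUeq, hφc, hφs, hφ1, hleft, hright⟩ := hcell.exists_c1_chart
      have hφC : MapsTo φ U C := fun u hu => (hright u hu).1
      have hg : IsSemialgebraicFunOn ℝ U (f i ∘ φ) :=
        IsSemialgebraicFunOn.comp_isSemialgebraicMapOn_holds ((hf i).mono hCA (h𝒟.isSemialgebraic C hC))
          hφs hφC
      obtain ⟨-, hIId⟩ := IH d hdm
      obtain ⟨ℬ, ⟨hℬ, -⟩, -, hℬU, hℬg⟩ := hIId Unit (fun _ => U) (fun _ => f i ∘ φ) (fun _ => hg) ∅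
        (by simp)
      let p : (Fin m → ℝ) → (Fin d → ℝ) := fun x => x ∘ ιC
      have hp : ContDiff ℝ 1 p := contDiff_pi.mpr fun j => contDiff_apply ℝ ℝ (ιC j)
      refine ⟨(ℬ.filter fun B => B ⊆ U).image fun B => C ∩ {x | p x ∈ B}, fun P hP => ?_, fun x hx => ?_⟩
      · obtain ⟨B, hB, rfl⟩ := Finset.mem_image.mp hP
        obtain ⟨hBℬ, hBU⟩ := Finset.mem_filter.mp hB
        refine ⟨(h𝒟.isSemialgebraic C hC).inter ((hℬ.isSemialgebraic B hBℬ).preimage_comp ιC), ?_⟩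
        have h1 : IsC1On ((f i ∘ φ) ∘ p) (C ∩ {x | p x ∈ B}) :=
          (hℬg () B hBℬ hBU).comp_contDiff hp fun x hx => hx.2
        exact h1.congr fun x hx => by
          show f i (φ (x ∘ ιC)) = f i x
          rw [hleft x hx.1]
      · have hxU : p x ∈ U := hUeq ▸ ⟨x, hx, rfl⟩
        obtain ⟨B, ⟨hB, hxB⟩, -⟩ := hℬ.isPartition.2 (p x)
        have hBU : B ⊆ U := by
          rcases hℬU () B hB with h | h
          · exact h
          · exact absurd (Set.disjoint_left.mp h hxB) (not_not.mpr hxU)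
        simp only [mem_iUnion, Finset.mem_image, Finset.mem_filter, exists_prop]
        exact ⟨_, ⟨B, ⟨hB, hBU⟩, rfl⟩, hx, hxB⟩
  choose! Pf hPf hPcover using hpieces
  -- second decomposition, partitioning the cells of the first and all the pieces
  set Pall : Finset (Set (Fin m → ℝ)) := 𝒟.biUnion fun C => Finset.univ.biUnion fun i =>
    if C ⊆ A i then Pf C i else ∅ with hPall
  have hPall' : ∀ P ∈ Pall, ∃ C ∈ 𝒟, ∃ i, C ⊆ A i ∧ P ∈ Pf C i := by
    intro P hP
    rw [hPall] at hP
    obtain ⟨C, hC, hP⟩ := Finset.mem_biUnion.mp hP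
    obtain ⟨i, -, hP⟩ := Finset.mem_biUnion.mp hP
    by_cases h : C ⊆ A i
    · rw [if_pos h] at hP
      exact ⟨C, hC, i, h, hP⟩
    · rw [if_neg h] at hP
      exact absurd hP (Finset.notMem_empty P)
  have hPcmem : ∀ C ∈ 𝒟, ∀ i, C ⊆ A i → ∀ P ∈ Pf C i, P ∈ Pall := by
    intro C hC i hCA P hP
    rw [hPall]
    refine Finset.mem_biUnion.mpr ⟨C, hC, Finset.mem_biUnion.mpr ⟨i, Finset.mem_univ _, ?_⟩⟩
    rw [if_pos hCA]
    exact hP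
  set 𝒜₂ : Finset (Set (Fin m → ℝ)) := 𝒜₁ ∪ 𝒟 ∪ Pall with h𝒜₂
  have h𝒜₂ : ∀ B ∈ 𝒜₂, IsSemialgebraic ℝ B := by
    intro B hB
    rcases Finset.mem_union.mp hB with hB | hB
    · rcases Finset.mem_union.mp hB with hB | hB
      · exact h𝒜₁ B hB
      · exact h𝒟.isSemialgebraic B hB
    · obtain ⟨C, hC, i, hCA, hP⟩ := hPall' B hB
      exact (hPf C hC i hCA B hP).1
  obtain ⟨𝒟₂, h𝒟₂, h𝒟₂adapt⟩ := hI 𝒜₂ h𝒜₂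
  have hA𝒜₂ : ∀ i, A i ∈ 𝒜₂ := fun i => Finset.mem_union_left _ (Finset.mem_union_left _
    (Finset.mem_union_left _ (Finset.mem_union_right _ (Finset.mem_image.mpr ⟨i, Finset.mem_univ _, rfl⟩))))
  refine ⟨𝒟₂, h𝒟₂, fun B hB C hC => h𝒟₂adapt B (Finset.mem_union_left _ (Finset.mem_union_left _
    (Finset.mem_union_left _ (Finset.mem_union_left _ hB)))) C hC, fun i C hC => h𝒟₂adapt _ (hA𝒜₂ i) C hC,
    fun i C' hC' hC'A => ?_⟩
  -- `f i` is `C¹` on the cells of `𝒟₂` inside `A i`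
  have hC'ne : C'.Nonempty := h𝒟₂.1.nonempty_of_mem hC'
  obtain ⟨z, hz⟩ := hC'ne
  obtain ⟨C, ⟨hC, hzC⟩, -⟩ := h𝒟.isPartition.2 z
  have hC'C : C' ⊆ C := by
    rcases h𝒟₂adapt C (Finset.mem_union_left _ (Finset.mem_union_right _ hC)) C' hC' with h | h
    · exact h
    · exact absurd (Set.disjoint_left.mp h hz) (not_not.mpr hzC)
  have hCA : C ⊆ A i := by
    have hA1 : A i ∈ 𝒜₁ := Finset.mem_union_left _ (Finset.mem_union_right _
      (Finset.mem_image.mpr ⟨i, Finset.mem_univ _, rfl⟩))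
    rcases h𝒟adapt _ hA1 C hC with h | h
    · exact h
    · exact absurd (Set.disjoint_left.mp h hzC) (not_not.mpr (hC'A hz))
  have hzP := hPcover C hC i hCA hzC
  simp only [mem_iUnion, exists_prop] at hzP
  obtain ⟨P, hP, hzP⟩ := hzP
  have hC'P : C' ⊆ P := by
    rcases h𝒟₂adapt P (Finset.mem_union_right _ (hPcmem C hC i hCA P hP)) C' hC' with h | h
    · exact h
    · exact absurd (Set.disjoint_left.mp h hz) (not_not.mpr hzP)
  exact (hPf C hC i hCA P hP).2.mono hC'P

/-- **`C¹` cell decomposition, `(I_m)`**: every finite family of semialgebraic subsets of `ℝᵐ` is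
partitioned by a cylindrical decomposition of `ℝᵐ` into `C¹` cells. [cite: Dries1998, Ch. 7 (3.2)] -/
theorem exists_c1CAD (𝒜 : Finset (Set (Fin m → ℝ))) (h𝒜 : ∀ A ∈ 𝒜, IsSemialgebraic ℝ A) :
    ∃ 𝒟 : Finset (Set (Fin m → ℝ)), IsC1CAD m 𝒟 ∧ ∀ A ∈ 𝒜, ∀ C ∈ 𝒟, C ⊆ A ∨ Disjoint C A :=
  (c1_cell_decomposition m).1 𝒜 h𝒜

/-- **`C¹` cell decomposition, `(II_m)`**: a semialgebraic function is `C¹` on the cells (inside its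
domain) of a suitable `C¹` cylindrical decomposition partitioning its domain and a given finite
family of semialgebraic sets. [cite: Dries1998, Ch. 7 (3.2)] -/
theorem exists_c1CAD_c1On {A : Set (Fin m → ℝ)} {f : (Fin m → ℝ) → ℝ} (hf : IsSemialgebraicFunOn ℝ A f)
    (𝒜 : Finset (Set (Fin m → ℝ))) (h𝒜 : ∀ B ∈ 𝒜, IsSemialgebraic ℝ B) :
    ∃ 𝒟 : Finset (Set (Fin m → ℝ)), IsC1CAD m 𝒟 ∧ (∀ B ∈ 𝒜, ∀ C ∈ 𝒟, C ⊆ B ∨ Disjoint C B) ∧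
      (∀ C ∈ 𝒟, C ⊆ A ∨ Disjoint C A) ∧ ∀ C ∈ 𝒟, C ⊆ A → IsC1On f C := by
  obtain ⟨𝒟, h𝒟, h1, h2, h3⟩ := (c1_cell_decomposition m).2 Unit (fun _ => A) (fun _ => f) (fun _ => hf) 𝒜 h𝒜
  exact ⟨𝒟, h𝒟, h1, h2 (), h3 ()⟩

end C1Decomposition

end Literature.ModelTheory.ExponentialFields
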